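import Literature.Algebra.Polynomial.QPalindromicRealCounterpart
import Mathlib.FieldTheory.IsAlgClosed.Basic
import HarnessLib

/-!
# Goresky–Tai 2017, App. §16.2: the roots of a `q`-palindromic polynomial — closed under `π ↦ q/π`,
# `p = ∏ⱼ (x − αⱼ)(x − q/αⱼ) = ∏ⱼ (x² − βⱼx + q)`, and the multiplicity of `±√q` is even

Topic `Literature/Algebra/Polynomial`; THEOREMS ONLY (no definition, no instance, no named fact; D-0026 net debt
0).  Lane `lit-hodgefound` (summit `HodgeConjecture`, Track 2 foundations library), seat `lit-hodgefound-p15`,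
generation 56, row g56-#10; sequel of `QPalindromicRealCounterpart` (g56-#1: the transform
`𝒯_q(h) = xⁿh(x + q/x) = ∑ⱼ hⱼ x^{n−j}(x² + q)ʲ`, `q`-palindromic ⟺ `p = 𝒯_q(h)`).

THE PRINT.  M. Goresky, Y.-S. Tai, *Real structures on ordinary Abelian varieties*, arXiv:1701.07742
[GoreskyTai2017RealStructuresOrdinary], App. §16.2 (p0036), verbatim:

> Let `q ∈ ℚ`. Let us say that a monic polynomial `p(x) = x^{2n} + a_{2n−1}x^{2n−1} + ⋯ + a₀ ∈ ℂ[x]` is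
> `q`-palindromic if it has even degree and if `a_{n−r} = qʳ a_{n+r}` for `1 ≤ r ≤ n`, or equivalently if
> `q^{−n} x^{2n} p(q/x) = p(x)`. Thus `p(x)` is `q`-palindromic iff the following holds: for every root `π` of
> `p(x)` the number `qπ⁻¹` is also a root of `p(x)`, and if `π` is a real root of `p(x)` then `π = ±√q` and its
> multiplicity is even. … Let `p(x) = ∏_{j=1}^n (x − αⱼ)(x − q/αⱼ) = ∑ aᵢxⁱ` …

and §16 Prop. 38's proof (p0037): «`p(x) = ∏ (x − λᵢ)(x − q/λᵢ) = ∏ (x² − (λᵢ + q/λᵢ)x + q)` where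
`λ₁, ⋯, λₙ, q/λ₁, ⋯, q/λₙ` are the roots of `p(x)`».

WHAT IS HERE (over an algebraically closed field `K` — GT's `ℂ` — with `q ≠ 0`; `p` monic of degree `2n`,
«`q`-palindromic» = the tree's `∀ r ≤ n, p.coeff (n − r) = q ^ r * p.coeff (n + r)` of `QPalindromicRealCounterpart`):
* §1 the quadratic factors `x² − βx + q = (x − π)(x − (β − π))`, `π(β − π) = q`: `exists_mul_sub_eq`,
  `X_sq_sub_eq_mul`, `roots_X_sq_sub`, `map_div_roots_X_sq_sub` (its root pair is swapped by `π ↦ q/π`),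
  `count_roots_X_sq_sub` (a square root `s` of `q` is a root iff `β = 2s`, and then a double one).
* §2 the transform of a split `h`: **`transform_eq_prod_roots`** (`𝒯_q(h) = ∏_{β ∈ roots h} (x² − βx + q)`, any
  field, `h` monic split), `roots_transform` (`roots 𝒯_q(h) = ⋃_β {π_β, β − π_β}`), **`map_div_roots_transform`**
  (closed under `π ↦ q/π`), **`count_roots_transform`** (the multiplicity of `s`, `s² = q`, in `𝒯_q(h)` is twice the
  multiplicity of `2s` in `h`).
* §3 for a `q`-PALINDROMIC `p` (through `p = 𝒯_q(h)`, `QPalindromicRealCounterpart.existsUnique_monic_eq_transform`):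
  **`map_div_roots_of_pal`** («for every root `π` of `p(x)` the number `qπ⁻¹` is also a root», with
  multiplicities: `p.roots.map (q / ·) = p.roots`), `mem_roots_div_of_pal`, `coeff_zero_eq_of_pal` (`a₀ = qⁿ`),
  **`even_count_roots_of_pal`** («if `π = ±√q` … its multiplicity is even»), and the converse
  **`pal_of_map_div_roots`** (`p.roots.map (q / ·) = p.roots` and `a₀ = qⁿ` ⟹ `q`-palindromic; by comparing
  `x^{2n}p(q/x)` and `qⁿp(x)` at every `x ≠ 0`), packaged as **`pal_iff_roots`**; over any field read in an algebraically closed extension (`ℚ ⊂ ℂ`): `pal_map`,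
  `map_div_roots_map_of_pal`, `even_count_roots_map_of_pal`.
* §4 scope of the printed sentence: `pal_X_sub_one_mul_X_sub_C` — `(x − 1)(x − q)` is `q`-palindromic (any
  commutative ring) although its roots `1, q` are real and `≠ ±√q` for `q ≠ 1`; so «if `π` is a real root then
  `π = ±√q`» is not part of a correct equivalence (the clause belongs to Weil `q`-polynomials WITHOUT real roots,
  cf. `RealCounterpartWeilPolynomial`), while `a₀ = qⁿ` is needed: `x² − q` has root set `{±√q}` closed under
  `π ↦ q/π` but is not `q`-palindromic (`RealCounterpartWeilPolynomial.not_pal_X_sq_sub_C`).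

## References
* [GoreskyTai2017RealStructuresOrdinary] M. Goresky, Y.-S. Tai, Real structures on ordinary Abelian varieties,
  arXiv:1701.07742 (2017), App. §16.2 (p0036) and the proof of Prop. 38 (p0037).
-/

open Polynomial Finset

namespace Literature.Algebra.Polynomial.QPalindromicRoots

variable {K : Type*} [Field K]

/-! ## §1 The quadratic factors `x² − βx + q` -/

/-- Over an algebraically closed field every `x² − βx + q` has a root `π`, i.e. `π(β − π) = q`.
[cite: GoreskyTai2017RealStructuresOrdinary, App. §16 proof of Prop. 38 «x² − (λᵢ + q/λᵢ)x + q» (p0037)] -/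
theorem exists_mul_sub_eq [IsAlgClosed K] (β q : K) : ∃ π : K, π * (β - π) = q := by
  have hmn := QPalindromicRealCounterpart.monic_transform q 1 (monic_X_sub_C β) (natDegree_X_sub_C β)
  rw [QPalindromicRealCounterpart.transform_X_sub_C] at hmn
  obtain ⟨π, hπ⟩ := IsAlgClosed.exists_root (X ^ 2 - C β * X + C q)
    (by rw [degree_eq_natDegree hmn.1.ne_zero, hmn.2]; norm_num)
  refine ⟨π, ?_⟩
  have h : π ^ 2 - β * π + q = 0 := by simpa using hπ
  linear_combination -h

/-- `x² − βx + q = (x − π)(x − (β − π))` when `π(β − π) = q`. [cite: GoreskyTai2017RealStructuresOrdinary, App. §16.2 «p(x) = ∏ (x − αⱼ)(x − q/αⱼ)» (p0036)] -/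
theorem X_sq_sub_eq_mul {β q π : K} (hπ : π * (β - π) = q) :
    (X ^ 2 - C β * X + C q : K[X]) = (X - C π) * (X - C (β - π)) := by
  rw [← hπ, map_mul, map_sub]
  ring

/-- The roots of `x² − βx + q` are `π` and `β − π = q/π`. [cite: GoreskyTai2017RealStructuresOrdinary, App. §16 proof of Prop. 38 (p0037)] -/
theorem roots_X_sq_sub {β q π : K} (hπ : π * (β - π) = q) :
    (X ^ 2 - C β * X + C q : K[X]).roots = {π, β - π} := by
  rw [X_sq_sub_eq_mul hπ, roots_mul (mul_ne_zero (X_sub_C_ne_zero π) (X_sub_C_ne_zero (β - π))), roots_X_sub_C,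
    roots_X_sub_C, Multiset.singleton_add, Multiset.insert_eq_cons]

/-- The root pair `{π, β − π}` of `x² − βx + q` (`q ≠ 0`) is swapped by `π ↦ q/π`.
[cite: GoreskyTai2017RealStructuresOrdinary, App. §16.2 «for every root π of p(x) the number qπ⁻¹ is also a root» (p0036)] -/
theorem map_div_roots_X_sq_sub {β q π : K} (hq : q ≠ 0) (hπ : π * (β - π) = q) :
    (X ^ 2 - C β * X + C q : K[X]).roots.map (fun x => q / x) = (X ^ 2 - C β * X + C q : K[X]).roots := by
  have hπ0 : π ≠ 0 := fun h => hq (by rw [← hπ, h, zero_mul])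
  have hπ1 : β - π ≠ 0 := fun h => hq (by rw [← hπ, h, mul_zero])
  rw [roots_X_sq_sub hπ]
  simp only [Multiset.insert_eq_cons, Multiset.map_cons, Multiset.map_singleton]
  rw [← hπ, mul_div_cancel_left₀ _ hπ0, mul_div_cancel_right₀ _ hπ1, ← Multiset.insert_eq_cons,
    ← Multiset.insert_eq_cons, Multiset.pair_comm]

/-- For a square root `s` of `q ≠ 0`: `s` is a root of `x² − βx + q` iff `β = 2s`, and then it is a double root
(`x² − 2sx + q = (x − s)²`). [cite: GoreskyTai2017RealStructuresOrdinary, App. §16.2 «π = ±√q and its multiplicity is even» (p0036)] -/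
theorem count_roots_X_sq_sub [DecidableEq K] {β q π s : K} (hq : q ≠ 0) (hπ : π * (β - π) = q)
    (hs : s ^ 2 = q) : (X ^ 2 - C β * X + C q : K[X]).roots.count s = if β = 2 * s then 2 else 0 := by
  have hs0 : s ≠ 0 := fun h => hq (by rw [← hs, h, zero_pow two_ne_zero])
  rw [roots_X_sq_sub hπ]
  split_ifs with hβ
  · -- `π(2s − π) = s²` forces `π = s`
    have hπs : π = s := by
      have h0 : (π - s) ^ 2 = 0 := by rw [hβ] at hπ; linear_combination hs - hπ
      exact sub_eq_zero.mp ((pow_eq_zero_iff two_ne_zero).mp h0)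
    subst hπs
    rw [hβ, two_mul, add_sub_cancel_left, Multiset.insert_eq_cons, Multiset.count_cons_self,
      Multiset.count_singleton_self]
  · rw [Multiset.count_eq_zero, Multiset.insert_eq_cons, Multiset.mem_cons, Multiset.mem_singleton, not_or]
    constructor
    · intro h
      subst h
      have h1 : s * (β - 2 * s) = 0 := by linear_combination hπ - hs
      rcases mul_eq_zero.mp h1 with h1 | h1
      · exact hs0 h1
      · exact hβ (sub_eq_zero.mp h1)
    · intro h
      have hπ' : π = β - s := by rw [h]; ring
      rw [hπ'] at hπ
      have h1 : s * (β - 2 * s) = 0 := by linear_combination hπ - hs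
      rcases mul_eq_zero.mp h1 with h1 | h1
      · exact hs0 h1
      · exact hβ (sub_eq_zero.mp h1)

/-- `∑ᵦ [β = a]·c = c · #{β = a}`. [folklore] -/
private theorem sum_map_ite_eq {α : Type*} [DecidableEq α] (m : Multiset α) (a : α) (c : ℕ) :
    (m.map fun b => if b = a then c else 0).sum = c * m.count a := by
  induction m using Multiset.induction_on with
  | empty => simp
  | cons b m ih =>
    rw [Multiset.map_cons, Multiset.sum_cons, ih, Multiset.count_cons]
    by_cases hb : b = a
    · subst hb
      rw [if_pos rfl, if_pos rfl]
      ring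
    · rw [if_neg hb, if_neg (Ne.symm hb)]
      ring

/-! ## §2 The transform of a split `h`: `𝒯_q(h) = ∏_β (x² − βx + q)` -/

/-- **`xⁿh(x + q/x) = ∏_{β ∈ roots h} (x² − βx + q)`** for a monic split `h` (any field).
[cite: GoreskyTai2017RealStructuresOrdinary, App. §16 proof of Prop. 38 «p(x) = ∏ (x − λᵢ)(x − q/λᵢ) = ∏ (x² − (λᵢ + q/λᵢ)x + q)» (p0037)] -/
theorem transform_eq_prod_roots (q : K) {n : ℕ} {h : K[X]} (hm : h.Monic) (hn : h.natDegree = n)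
    (hsplit : h.Splits) :
    (∑ j ∈ Finset.range (n + 1), C (h.coeff j) * X ^ (n - j) * (X ^ 2 + C q) ^ j) =
      (h.roots.map fun β => X ^ 2 - C β * X + C q).prod := by
  have hcard : Multiset.card h.roots = n := by rw [← hn, hsplit.natDegree_eq_card_roots]
  have hh : h = (h.roots.map (X - C ·)).prod := hsplit.eq_prod_roots_of_monic hm
  rw [← QPalindromicRealCounterpart.transform_multiset_prod_X_sub_C q h.roots, hcard, ← hh]

/-- No quadratic factor vanishes. [folklore] -/
private theorem zero_notMem_map (q : K) (m : Multiset K) :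
    (0 : K[X]) ∉ m.map fun β => X ^ 2 - C β * X + C q := by
  rw [Multiset.mem_map]
  rintro ⟨β, -, hβ⟩
  have hmn := QPalindromicRealCounterpart.monic_transform q 1 (monic_X_sub_C β) (natDegree_X_sub_C β)
  rw [QPalindromicRealCounterpart.transform_X_sub_C, hβ] at hmn
  exact hmn.1.ne_zero rfl

/-- Over an algebraically closed field: the roots of `𝒯_q(h)` are the pairs `{π_β, β − π_β}`, `β` a root of `h`.
[cite: GoreskyTai2017RealStructuresOrdinary, App. §16 proof of Prop. 38 «λ₁, ⋯, λₙ, q/λ₁, ⋯, q/λₙ are the roots of p(x)» (p0037)] -/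
theorem roots_transform [IsAlgClosed K] (q : K) {n : ℕ} {h : K[X]} (hm : h.Monic) (hn : h.natDegree = n) :
    (∑ j ∈ Finset.range (n + 1), C (h.coeff j) * X ^ (n - j) * (X ^ 2 + C q) ^ j).roots =
      h.roots.bind fun β => (X ^ 2 - C β * X + C q : K[X]).roots := by
  rw [transform_eq_prod_roots q hm hn (IsAlgClosed.splits h), roots_multiset_prod _ (zero_notMem_map q _),
    Multiset.bind_map]

/-- **The roots of `𝒯_q(h)` (`q ≠ 0`) are permuted by `π ↦ q/π`** (with multiplicities).
[cite: GoreskyTai2017RealStructuresOrdinary, App. §16.2 «for every root π of p(x) the number qπ⁻¹ is also a root of p(x)» (p0036)] -/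
theorem map_div_roots_transform [IsAlgClosed K] {q : K} (hq : q ≠ 0) {n : ℕ} {h : K[X]} (hm : h.Monic)
    (hn : h.natDegree = n) :
    (∑ j ∈ Finset.range (n + 1), C (h.coeff j) * X ^ (n - j) * (X ^ 2 + C q) ^ j).roots.map
        (fun x => q / x) =
      (∑ j ∈ Finset.range (n + 1), C (h.coeff j) * X ^ (n - j) * (X ^ 2 + C q) ^ j).roots := by
  rw [roots_transform q hm hn, Multiset.map_bind]
  refine Multiset.bind_congr fun β _ => ?_
  obtain ⟨π, hπ⟩ := exists_mul_sub_eq β q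
  exact map_div_roots_X_sq_sub hq hπ

/-- **Multiplicity of `±√q`**: for `s² = q ≠ 0` the multiplicity of `s` as a root of `𝒯_q(h)` is twice the
multiplicity of `2s` as a root of `h`. [cite: GoreskyTai2017RealStructuresOrdinary, App. §16.2 «if π = ±√q … its multiplicity is even» (p0036)] -/
theorem count_roots_transform [IsAlgClosed K] [DecidableEq K] {q s : K} (hq : q ≠ 0) (hs : s ^ 2 = q) {n : ℕ}
    {h : K[X]} (hm : h.Monic) (hn : h.natDegree = n) :
    (∑ j ∈ Finset.range (n + 1), C (h.coeff j) * X ^ (n - j) * (X ^ 2 + C q) ^ j).roots.count s =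
      2 * h.roots.count (2 * s) := by
  rw [roots_transform q hm hn, Multiset.count_bind]
  have hc : (h.roots.map fun β => ((X ^ 2 - C β * X + C q : K[X]).roots.count s)) =
      h.roots.map fun β => if β = 2 * s then 2 else 0 := by
    refine Multiset.map_congr rfl fun β _ => ?_
    obtain ⟨π, hπ⟩ := exists_mul_sub_eq β q
    exact count_roots_X_sq_sub hq hπ hs
  rw [hc, sum_map_ite_eq]

/-! ## §3 `q`-palindromic polynomials -/

/-- `a₀ = qⁿ` for a monic `q`-palindromic `p` of degree `2n` (any semiring: `r = n` in the definition).
[cite: GoreskyTai2017RealStructuresOrdinary, App. §16.2 «a_{n−r} = qʳ a_{n+r} for 1 ≤ r ≤ n» (p0036)] -/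
theorem coeff_zero_eq_of_pal {R : Type*} [Semiring R] {q : R} {n : ℕ} {p : R[X]} (hm : p.Monic)
    (hp : p.natDegree = 2 * n) (hpal : ∀ r ≤ n, p.coeff (n - r) = q ^ r * p.coeff (n + r)) :
    p.coeff 0 = q ^ n := by
  have h := hpal n le_rfl
  rw [Nat.sub_self, ← two_mul, ← hp, hm.coeff_natDegree, mul_one] at h
  exact h

/-- **«For every root `π` of `p(x)` the number `qπ⁻¹` is also a root»**, with multiplicities: the root multiset
of a monic `q`-palindromic `p` of degree `2n` (`q ≠ 0`, algebraically closed field) is invariant under `π ↦ q/π`.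
[cite: GoreskyTai2017RealStructuresOrdinary, App. §16.2 (p0036)] -/
theorem map_div_roots_of_pal [IsAlgClosed K] {q : K} (hq : q ≠ 0) (n : ℕ) {p : K[X]} (hm : p.Monic)
    (hp : p.natDegree = 2 * n) (hpal : ∀ r ≤ n, p.coeff (n - r) = q ^ r * p.coeff (n + r)) :
    p.roots.map (fun x => q / x) = p.roots := by
  obtain ⟨h, ⟨hhm, hhn⟩, hph⟩ :=
    (QPalindromicRealCounterpart.existsUnique_monic_eq_transform q n p hm hp hpal).exists
  rw [hph]
  exact map_div_roots_transform hq hhm hhn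

/-- Elementwise: `π` a root ⟹ `q/π` a root. [cite: GoreskyTai2017RealStructuresOrdinary, App. §16.2 (p0036)] -/
theorem isRoot_div_of_pal [IsAlgClosed K] {q : K} (hq : q ≠ 0) (n : ℕ) {p : K[X]} (hm : p.Monic)
    (hp : p.natDegree = 2 * n) (hpal : ∀ r ≤ n, p.coeff (n - r) = q ^ r * p.coeff (n + r)) {π : K}
    (hπ : p.IsRoot π) : p.IsRoot (q / π) := by
  have h : q / π ∈ p.roots := by
    rw [← map_div_roots_of_pal hq n hm hp hpal]
    exact Multiset.mem_map_of_mem _ ((mem_roots hm.ne_zero).mpr hπ)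
  exact (mem_roots hm.ne_zero).mp h

/-- **«If `π = ±√q` then its multiplicity is even»**: for `s² = q ≠ 0`, the multiplicity of `s` as a root of a monic
`q`-palindromic `p` is even (it is twice the multiplicity of `2s` as a root of the real counterpart `h`).
[cite: GoreskyTai2017RealStructuresOrdinary, App. §16.2 (p0036)] -/
theorem even_count_roots_of_pal [IsAlgClosed K] [DecidableEq K] {q s : K} (hq : q ≠ 0) (hs : s ^ 2 = q) (n : ℕ)
    {p : K[X]} (hm : p.Monic) (hp : p.natDegree = 2 * n)
    (hpal : ∀ r ≤ n, p.coeff (n - r) = q ^ r * p.coeff (n + r)) : Even (p.roots.count s) := by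
  obtain ⟨h, ⟨hhm, hhn⟩, hph⟩ :=
    (QPalindromicRealCounterpart.existsUnique_monic_eq_transform q n p hm hp hpal).exists
  rw [hph, count_roots_transform hq hs hhm hhn]
  exact even_two_mul _

/-- `x^{2n} p(q/x)` evaluated: for `x ≠ 0`, `(reflect (2n) (p ∘ qx))(x) = x^{2n} p(q/x)`.
[cite: GoreskyTai2017RealStructuresOrdinary, App. §16.2 «q^{−n} x^{2n} p(q/x) = p(x)» (p0036)] -/
theorem eval_reflect_comp_C_mul_X {q : K} (hq : q ≠ 0) {n : ℕ} {p : K[X]} (hp : p.natDegree = 2 * n) {x : K}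
    (hx : x ≠ 0) : ((p.comp (C q * X)).reflect (2 * n)).eval x = x ^ (2 * n) * p.eval (q / x) := by
  haveI : Invertible x⁻¹ := invertibleOfNonzero (inv_ne_zero hx)
  have hdeg : (p.comp (C q * X)).natDegree ≤ 2 * n := by
    rw [natDegree_comp, natDegree_C_mul_X q hq, mul_one, hp]
  have h := eval₂_reflect_mul_pow (RingHom.id K) x⁻¹ (2 * n) (p.comp (C q * X)) hdeg
  rw [invOf_eq_inv, inv_inv] at h
  change ((p.comp (C q * X)).reflect (2 * n)).eval x * x⁻¹ ^ (2 * n) = (p.comp (C q * X)).eval x⁻¹ at h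
  rw [eval_comp, eval_mul, eval_C, eval_X, ← div_eq_mul_inv] at h
  rw [← h, inv_pow, mul_left_comm, mul_inv_cancel₀ (pow_ne_zero _ hx), mul_one]

/-- **Converse**: a monic `p` of degree `2n` over an algebraically closed field whose root multiset is invariant
under `π ↦ q/π` (`q ≠ 0`) and whose constant coefficient is `qⁿ` is `q`-palindromic (`x^{2n}p(q/x) = qⁿp(x)` at
every `x ≠ 0`). [cite: GoreskyTai2017RealStructuresOrdinary, App. §16.2 «or equivalently if q^{−n} x^{2n} p(q/x) = p(x). Thus p(x) is q-palindromic iff … for every root π of p(x) the number qπ⁻¹ is also a root» (p0036)] -/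
theorem pal_of_map_div_roots [IsAlgClosed K] {q : K} (hq : q ≠ 0) (n : ℕ) {p : K[X]} (hm : p.Monic)
    (hp : p.natDegree = 2 * n) (hroots : p.roots.map (fun x => q / x) = p.roots) (h0 : p.coeff 0 = q ^ n) :
    ∀ r ≤ n, p.coeff (n - r) = q ^ r * p.coeff (n + r) := by
  have hsplit : p.Splits := IsAlgClosed.splits p
  have hcard : Multiset.card p.roots = 2 * n := by rw [← hp, hsplit.natDegree_eq_card_roots]
  have hprod : p.roots.prod = q ^ n := by
    rw [← h0, hsplit.coeff_zero_eq_prod_roots_of_monic hm, hp, pow_mul, neg_one_sq, one_pow, one_mul]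
  have h0r : (0 : K) ∉ p.roots := fun h => by
    have := Multiset.prod_eq_zero h
    rw [hprod] at this
    exact pow_ne_zero _ hq this
  refine QPalindromicRealCounterpart.pal_of_reflect_comp_C_mul_X (mem_nonZeroDivisors_of_ne_zero hq) ?_
  apply Polynomial.eq_of_infinite_eval_eq
  refine Set.Infinite.mono (s := ({0}ᶜ : Set K)) (fun x hx => ?_) (Set.finite_singleton (0 : K)).infinite_compl
  have hx : x ≠ 0 := hx
  rw [Set.mem_setOf_eq, eval_reflect_comp_C_mul_X hq hp hx, eval_mul, eval_C,
    hsplit.eval_eq_prod_roots_of_monic hm, hsplit.eval_eq_prod_roots_of_monic hm]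
  -- rewrite the first product over `roots = roots.map (q / ·)`
  conv_lhs => rw [← hroots, Multiset.map_map]
  have hpt : ∀ π ∈ p.roots, ((fun y => q / x - y) ∘ fun y => q / y) π = -(q / x) * (π⁻¹ * (x - π)) := by
    intro π hπ
    have hπ0 : π ≠ 0 := fun h => h0r (h ▸ hπ)
    simp only [Function.comp_apply]
    field_simp
    ring
  rw [Multiset.map_congr rfl hpt, Multiset.prod_map_mul, Multiset.map_const', Multiset.prod_replicate, hcard,
    Multiset.prod_map_mul, Multiset.prod_map_inv, Multiset.map_id', hprod, Even.neg_pow (even_two_mul n), div_pow,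
    ← mul_assoc, mul_div_assoc', mul_div_cancel_left₀ _ (pow_ne_zero _ hx), two_mul, pow_add, mul_assoc,
    ← mul_assoc (q ^ n) (q ^ n)⁻¹, mul_inv_cancel₀ (pow_ne_zero n hq), one_mul]

/-- **`q`-PALINDROMIC ⟺ ROOTS CLOSED UNDER `π ↦ q/π` AND `a₀ = qⁿ`** (monic `p` of degree `2n` over an
algebraically closed field, `q ≠ 0`). [cite: GoreskyTai2017RealStructuresOrdinary, App. §16.2 «Thus p(x) is q-palindromic iff the following holds: for every root π of p(x) the number qπ⁻¹ is also a root of p(x) …» (p0036)] -/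
theorem pal_iff_roots [IsAlgClosed K] {q : K} (hq : q ≠ 0) (n : ℕ) {p : K[X]} (hm : p.Monic)
    (hp : p.natDegree = 2 * n) :
    (∀ r ≤ n, p.coeff (n - r) = q ^ r * p.coeff (n + r)) ↔
      p.roots.map (fun x => q / x) = p.roots ∧ p.coeff 0 = q ^ n :=
  ⟨fun hpal => ⟨map_div_roots_of_pal hq n hm hp hpal, coeff_zero_eq_of_pal hm hp hpal⟩,
    fun h => pal_of_map_div_roots hq n hm hp h.1 h.2⟩

/-- `q`-palindromic is preserved by every ring map (coefficientwise condition). [cite: GoreskyTai2017RealStructuresOrdinary, App. §16.2 «a_{n−r} = qʳ a_{n+r}» (p0036)] -/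
theorem pal_map {R S : Type*} [CommSemiring R] [CommSemiring S] (f : R →+* S) {q : R} {n : ℕ} {p : R[X]}
    (hpal : ∀ r ≤ n, p.coeff (n - r) = q ^ r * p.coeff (n + r)) :
    ∀ r ≤ n, (p.map f).coeff (n - r) = f q ^ r * (p.map f).coeff (n + r) := by
  intro r hr
  rw [coeff_map, coeff_map, hpal r hr, map_mul, map_pow]

/-- Over an arbitrary field `K`, read in any algebraically closed extension `f : K → L` (e.g. `ℚ ⊂ ℂ` as printed):
the roots of a monic `q`-palindromic `p` in `L` are permuted by `π ↦ q/π`.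
[cite: GoreskyTai2017RealStructuresOrdinary, App. §16.2 (p0036)] -/
theorem map_div_roots_map_of_pal {L : Type*} [Field L] [IsAlgClosed L] (f : K →+* L) {q : K} (hq : q ≠ 0)
    (n : ℕ) {p : K[X]} (hm : p.Monic) (hp : p.natDegree = 2 * n)
    (hpal : ∀ r ≤ n, p.coeff (n - r) = q ^ r * p.coeff (n + r)) :
    (p.map f).roots.map (fun x => f q / x) = (p.map f).roots :=
  map_div_roots_of_pal ((map_ne_zero f).mpr hq) n (hm.map f) (by rw [natDegree_map, hp]) (pal_map f hpal)

/-- … and the multiplicity in `L` of a square root `s` of `f(q)` is even.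
[cite: GoreskyTai2017RealStructuresOrdinary, App. §16.2 (p0036)] -/
theorem even_count_roots_map_of_pal {L : Type*} [Field L] [IsAlgClosed L] [DecidableEq L] (f : K →+* L) {q : K}
    (hq : q ≠ 0) {s : L} (hs : s ^ 2 = f q) (n : ℕ) {p : K[X]} (hm : p.Monic) (hp : p.natDegree = 2 * n)
    (hpal : ∀ r ≤ n, p.coeff (n - r) = q ^ r * p.coeff (n + r)) : Even ((p.map f).roots.count s) :=
  even_count_roots_of_pal ((map_ne_zero f).mpr hq) hs n (hm.map f) (by rw [natDegree_map, hp]) (pal_map f hpal)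

/-! ## §4 Scope of the printed sentence -/

/-- `(x − 1)(x − q) = x·(x + q/x − (1 + q)) = 𝒯_q(x − (1 + q))` is `q`-palindromic over any commutative ring
— although its roots `1, q` are «real» and, for `q ≠ 1`, different from `±√q`: the printed clause «if `π` is a
real root of `p(x)` then `π = ±√q`» is not part of a correct characterisation of `q`-palindromic polynomials (it
describes Weil `q`-polynomials without real roots). [cite: GoreskyTai2017RealStructuresOrdinary, App. §16.2 (p0036)] -/
theorem pal_X_sub_one_mul_X_sub_C {R : Type*} [CommRing R] (q : R) :
    ∀ r ≤ 1, ((X - 1) * (X - C q) : R[X]).coeff (1 - r) = q ^ r * ((X - 1) * (X - C q) : R[X]).coeff (1 + r) := by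
  have e : ((X - 1) * (X - C q) : R[X]) =
      ∑ j ∈ Finset.range (1 + 1), C ((X - C (1 + q)).coeff j) * X ^ (1 - j) * (X ^ 2 + C q) ^ j := by
    rw [QPalindromicRealCounterpart.transform_X_sub_C, map_add, map_one]
    ring
  rw [e]
  exact fun r hr => QPalindromicRealCounterpart.transform_pal q 1 _ hr

/-- … and its roots are `1` and `q` (over a field). [cite: GoreskyTai2017RealStructuresOrdinary, App. §16.2 (p0036)] -/
theorem roots_X_sub_one_mul_X_sub_C (q : K) : ((X - 1) * (X - C q) : K[X]).roots = {1, q} := by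
  rw [show (X - 1 : K[X]) = X - C 1 by rw [map_one],
    roots_mul (mul_ne_zero (X_sub_C_ne_zero 1) (X_sub_C_ne_zero q)), roots_X_sub_C, roots_X_sub_C,
    Multiset.singleton_add, Multiset.insert_eq_cons]

end Literature.Algebra.Polynomial.QPalindromicRoots
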